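import Summits.FinalStateConjecture.FinalStateConjecture.Theses.PhaseMixingCapture
import Summits.FinalStateConjecture.FinalStateConjecture.Theorems.PhaseMixingCaptureWeakCosmicCensorshipMGHDStubScriTransfer
import Summits.FinalStateConjecture.FinalStateConjecture.Theorems.WeakCosmicCensorshipMGHD.Negative.LoadBearing
import Literature.Geometry.Lorentzian.MGHDUniqueness
import Literature.Geometry.Lorentzian.CauchyDevelopmentIsometryClasses
import Literature.Geometry.Lorentzian.InitialDataPullback
import HarnessLib

/-!
# Route PhaseMixingCapture · crux `WeakCosmicCensorshipMGHD` (stmt-FinalStateConjecture-9952) —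
# complete `𝓘⁺` ASCENDS along embeddings of Cauchy developments and is an invariant of the
# isometry class of the MGHD; the crux's `∃ ∧ ∀` bundling collapses unconditionally

By-products of the line `scri-transfer-third-of-burial` for the crux itself.  The landed lever
`stub_scriTransfer` (`…PhaseMixingCaptureWeakCosmicCensorshipMGHDStubScriTransfer.lean`: far-origin
sojourn completeness of a sub-development ascends along an embedding over a sub-datum) specialised to the
identity sub-datum `Φ = id`, `N = X`, `K = ∅` gives:

* `hasCompleteNullInfinity_of_embedsInto` — if a Cauchy development `𝒟₁` of `D` embeds into a Cauchy
  development `𝒟₂` of the same data (`CauchyDevelopment.EmbedsInto`: a smooth, time-orientation preserving,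
  isometric open embedding commuting with the data embeddings) and `𝒟₁` has complete future null infinity
  in Christodoulou's sojourn form (`Summit.FinalStateConjecture.HasCompleteNullInfinity`), then so does
  `𝒟₂`.  (The converse — DESCENT — is false: the time-truncated Minkowski development embeds into Minkowski
  space, `Negative/TruncatedMinkowski.lean`.)
* `hasCompleteNullInfinity_iff_of_isIsometricTo` — completeness of `𝓘⁺` is an invariant of isometric
  Cauchy developments; `completeNullInfinityInvariant` — VERBATIM the hypothesis
  `CompleteNullInfinityInvariant` under which §3 of the standing disprover's
  `Cruxes/WeakCosmicCensorshipMGHD/Disproof.lean` runs, now a theorem.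
* `wccProperty_iff_exists` — consequently the property bundled by the crux, "an MGHD exists AND every
  MGHD has complete `𝓘⁺`", is equivalent to "SOME MGHD has complete `𝓘⁺`", by the PROVED uniqueness of
  the MGHD up to isometry (`mghd_unique_cauchy`, `MGHDUniqueness.lean`) — unconditionally (the disprover's
  `mem_wccSet_iff_exists` had `CompleteNullInfinityInvariant` as a hypothesis).

References: Christodoulou, CQG 16 (1999) A23, pp. A26–A27; Dafermos–Rodnianski arXiv:0811.0354, §2.6.2;
Choquet-Bruhat–Geroch, CMP 14 (1969), Thm. 3; Sbierski, Ann. Henri Poincaré 17 (2016), Thm. 2.8.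
-/

-- the doubled `FinalStateConjecture` path component is the summit/problem naming scheme
set_option linter.dupNamespace false

noncomputable section

open Set Function
open scoped Manifold ContDiff Topology
open Literature.Geometry.Lorentzian

namespace Summit.FinalStateConjecture.FinalStateConjecture.Theorems.PhaseMixingCapture.WeakCosmicCensorshipMGHD

section Ascent

variable {X : Type} [TopologicalSpace X] [ChartedSpace E3 X] [IsManifold (𝓡 3) ∞ X] [ConnectedSpace X]

/-- **Complete `𝓘⁺` ascends along embeddings of Cauchy developments of the same data.**  If
`𝒟₁ ↪ 𝒟₂` (`CauchyDevelopment.EmbedsInto`) and `𝒟₁` has complete future null infinity in the sojourn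
form, then `𝒟₂` has complete future null infinity: the lever `stub_scriTransfer` with the identity
sub-datum (`N = X`, `Φ = id`, `K = ∅`), the reference/exempted compact sets of the relative hypothesis being
the `B₀, B₁` of `𝒟₁`'s completeness.  `X` is automatically Hausdorff and second countable (it embeds into
the carrier of `𝒟₁`). -/
theorem hasCompleteNullInfinity_of_embedsInto {D : InitialDataSet (𝓡 3) X}
    (𝒟₁ 𝒟₂ : CauchyDevelopment D) (h : 𝒟₁.EmbedsInto 𝒟₂)
    (h₁ : Summit.FinalStateConjecture.HasCompleteNullInfinity 𝒟₁) :
    Summit.FinalStateConjecture.HasCompleteNullInfinity 𝒟₂ := by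
  haveI : T2Space X :=
    Summit.FinalStateConjecture.FinalStateConjecture.Theorems.WeakCosmicCensorshipMGHD.Negative.t2Space_of_dataEmbedding
      𝒟₁.toDataEmbedding
  haveI : SecondCountableTopology X :=
    𝒟₁.isSmoothEmbedding.isEmbedding.isInducing.secondCountableTopology
  have hΦ : ContMDiff (𝓡 3) (𝓡 3) (∞ + 1) (id : X → X) := contMDiff_id
  have hΦ' : ∀ u : X, Function.Injective (mfderiv (𝓡 3) (𝓡 3) (id : X → X) u) := fun u ↦ by
    rw [mfderiv_id]
    exact fun v w hvw ↦ hvw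
  obtain ⟨ψ, hψs, hψo, hψi, hψt, hψe⟩ := h
  -- the lever, with its sub-datum binder `DataEmbedding (D.comap id …)` generalised to a name `D'`
  have key : ∀ (D' : InitialDataSet (𝓡 3) X), D.comap id hΦ hΦ' = D' →
      ∀ (𝒮 : DataEmbedding D') (χ : 𝒮.carrier → 𝒟₂.carrier),
        ContMDiff (𝓡 4) (𝓡 4) ∞ χ → Topology.IsOpenEmbedding χ →
        𝒮.metric.IsIsometricImmersion 𝒟₂.metric.toPseudoRiemannianMetric χ →
        𝒮.timeOrientation.PreservesTimeOrientation χ 𝒟₂.timeOrientation →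
        χ ∘ 𝒮.embed = 𝒟₂.embed ∘ id →
        (∀ [𝒮.metric.HasLeviCivita],
          ∃ K₀ : Set X, IsCompact K₀ ∧ ∀ s : ℝ, 0 < s → ∃ K₁ : Set X, IsCompact K₁ ∧
            ∀ p : X, id p ∉ K₁ → ∀ (γ : ℝ → 𝒮.carrier) (dom : Set ℝ),
              𝒮.metric.IsNormalisedNullRayFrom 𝒮.timeOrientation 𝒮.embed 𝒮.normal p γ dom →
              ¬ BddAbove dom ∨ ENNReal.ofReal s ≤ sojournTime γ dom
                (𝒮.metric.causalFuture 𝒮.timeOrientation (𝒮.embed '' (id ⁻¹' K₀)))) →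
        Summit.FinalStateConjecture.HasCompleteNullInfinity 𝒟₂ := by
    intro D' e
    subst e
    intro 𝒮 χ hχ hχo hiso hτ hcomm hrel
    exact stub_scriTransfer X D 𝒟₂ X id hΦ hΦ' Topology.IsOpenEmbedding.id 𝒮 χ hχ hχo hiso hτ hcomm
      ∅ isCompact_empty (by simp) hrel
  -- `HasCompleteNullInfinity 𝒟₂` binds the Levi-Civita instance of `𝒟₂`; introduce it first
  intro hLC₂
  refine key D (D.comap_eq_self_of_eq_id hΦ hΦ' rfl) 𝒟₁.toDataEmbedding ψ hψs hψo hψi hψt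
    (by rw [hψe]; rfl) ?_
  intro _inst
  obtain ⟨B₀, hB₀, hs⟩ := @h₁ _inst
  refine ⟨B₀, hB₀, fun s hs' ↦ ?_⟩
  obtain ⟨B₁, hB₁, hp⟩ := hs s hs'
  exact ⟨B₁, hB₁, fun p hpB γ dom hγ ↦ hp p hpB γ dom hγ⟩

/-- **Complete `𝓘⁺` is an invariant of isometric Cauchy developments** (isometric developments embed
into each other). -/
theorem hasCompleteNullInfinity_iff_of_isIsometricTo {D : InitialDataSet (𝓡 3) X}
    (𝒟₁ 𝒟₂ : CauchyDevelopment D) (h : 𝒟₁.IsIsometricTo 𝒟₂) :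
    Summit.FinalStateConjecture.HasCompleteNullInfinity 𝒟₁ ↔
      Summit.FinalStateConjecture.HasCompleteNullInfinity 𝒟₂ := by
  exact ⟨hasCompleteNullInfinity_of_embedsInto 𝒟₁ 𝒟₂ (CauchyDevelopment.IsIsometricTo.embedsInto h),
    hasCompleteNullInfinity_of_embedsInto 𝒟₂ 𝒟₁ (CauchyDevelopment.IsIsometricTo.embedsInto h.symm)⟩

end Ascent

/-- **`CompleteNullInfinityInvariant` of the standing disprover's `Disproof.lean` §3, as a theorem**
(verbatim statement): a time-orientation preserving isometric diffeomorphism of vacuum Cauchy developments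
commuting with the embeddings transports complete `𝓘⁺` (sojourn form). -/
theorem completeNullInfinityInvariant :
    ∀ (X : Type) [TopologicalSpace X] [ChartedSpace E3 X]
      [IsManifold (modelWithCornersSelf ℝ E3) ((⊤ : ℕ∞) : WithTop ℕ∞) X] [ConnectedSpace X]
      (D : InitialDataSet (modelWithCornersSelf ℝ E3) X) (𝒟₁ 𝒟₂ : VacuumCauchyDevelopment D),
      𝒟₁.toCauchyDevelopment.IsIsometricTo 𝒟₂.toCauchyDevelopment →
      Summit.FinalStateConjecture.HasCompleteNullInfinity 𝒟₁.toCauchyDevelopment →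
      Summit.FinalStateConjecture.HasCompleteNullInfinity 𝒟₂.toCauchyDevelopment :=
  fun _ _ _ _ _ _ 𝒟₁ 𝒟₂ h ↦
    (hasCompleteNullInfinity_iff_of_isIsometricTo 𝒟₁.toCauchyDevelopment 𝒟₂.toCauchyDevelopment h).1

/-- **The crux's `∃ ∧ ∀` bundling collapses, unconditionally.**  For any datum `D`, "a maximal vacuum
Cauchy development exists AND every maximal one has complete `𝓘⁺`" — the property whose
Christodoulou-genericity `WeakCosmicCensorshipMGHD` asserts — is equivalent to "SOME maximal vacuum Cauchy
development has complete `𝓘⁺`": all MGHDs are isometric (`mghd_unique_cauchy`, proved) and completeness is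
an isometry invariant (`completeNullInfinityInvariant`).  This is the `∃`-form a stability-type argument
produces. -/
theorem wccProperty_iff_exists {X : Type} [TopologicalSpace X] [ChartedSpace E3 X]
    [IsManifold (𝓡 3) ∞ X] [ConnectedSpace X] (D : InitialDataSet (𝓡 3) X) :
    ((∃ 𝒟 : VacuumCauchyDevelopment D, 𝒟.IsMaximal) ∧
        ∀ 𝒟 : VacuumCauchyDevelopment D, 𝒟.IsMaximal →
          Summit.FinalStateConjecture.HasCompleteNullInfinity 𝒟.toCauchyDevelopment) ↔
      ∃ 𝒟 : VacuumCauchyDevelopment D, 𝒟.IsMaximal ∧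
        Summit.FinalStateConjecture.HasCompleteNullInfinity 𝒟.toCauchyDevelopment := by
  constructor
  · rintro ⟨⟨𝒟, hmax⟩, hall⟩
    exact ⟨𝒟, hmax, hall 𝒟 hmax⟩
  · rintro ⟨𝒟, hmax, hcomp⟩
    exact ⟨⟨𝒟, hmax⟩, fun 𝒟' hmax' ↦
      completeNullInfinityInvariant X D 𝒟 𝒟' (mghd_unique_cauchy 𝒟 𝒟' hmax hmax') hcomp⟩

end Summit.FinalStateConjecture.FinalStateConjecture.Theorems.PhaseMixingCapture.WeakCosmicCensorshipMGHD

end
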